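import Literature.Probability.Percolation.MarkedLoopTripodBasis
import Literature.Probability.Percolation.MarkedLoopSevenClasses
import HarnessLib

/-!
# The tripod pictures of seven disorders are the 63 readings («PICTURES-SEVEN», classification)

Topic `Literature/Probability/Percolation`; generic-`k` layer at `k = 7`, a rider on `MarkedLoopTripodBasis.lean` (`TripodPicture.isPattern_lo`; and, as PRIVATE
copies for import economy while `MarkedLoopTripodBasisSeven.olean` is unbuilt, that file's `rel₇` / `relation_seven` — the relation of a pattern of seven corners with
partner `j` is one of the five non-crossing matchings) and `MarkedLoopSevenClasses.lean` (the 63 readings `reading a r` of the 21 classes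
cons/adj, cons/nest, mid; `pics7`; every reading is a tripod picture). THE k = 7 ANALOGUE OF NEC5's `tripodPicture_five`: ★★ `tripodPicture_seven_mem`
— every tripod picture `(α, β, γ; L₀)` on seven corners is one of the 63 readings (proof: `isPattern_lo` + `relation_seven` + one `decide` on a
planarity-aware bookkeeping lemma); ★★ `tripodPicture_seven_iff`; hence ★ `tripodLaw_seven_iff`: AT SEVEN MARKS THE TRIPOD LAW IS TWENTY-ONE
RELATIONS `A_a = N_a = M_a = 0` (the class defects of SEVEN-CLASSES) — the classification input of the necessity theorem
(`MarkedLoopNecessitySevenIff.lean`).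

## References
* M. Khristoforov, S. Smirnov, *Percolation and O(1) loop model*, arXiv:2111.15612 (2021), §1.2 (arXiv v1 p. 2), §2 Lemma 4 and Fig. 3 (p. 4).

## Mathlib / tree
Tree: `MarkedLoopTripodBasis.lean` (`IsPattern`, `TripodPicture.isPattern_lo`; `MarkedLoopTripodBasisSeven.lean`'s `rel₇`/`relation_seven` re-proved privately here), `MarkedLoopSevenClasses.lean`
(`adjRel`, `nestRel`, `midRel`, `reading`, `pics7`, `mem_pics7`, `tripodPicture_of_mem_pics7`, `decCcwTriple`, `decCcwQuad`, `defA`, `defN`, `defM`,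
`defectAt_reading_*`, `classDefects_eq_zero_of_tripodLaw`), `MarkedLoopHolomorphicDefect.lean` (`tripodLaw_iff_tripodDefect`, `defectAt`). Mathlib: `decide`.
-/

open Finset

namespace Literature.Probability.Percolation.MarkedLoops

open Literature.Probability.Percolation

/-! ### Private copies of SOLVED-SEVEN's relation census (import economy) -/

/-- (private copy of the tree's `MarkedLoopTripodBasisSeven.rel₇'`, for import economy while its olean is unbuilt) the five non-crossing perfect matchings of the six corners `j+1, …, j+6` other than the partner `j`, as relations (both orientations):
`m = 0`: `{12,34,56}`, `1`: `{12,36,45}`, `2`: `{14,23,56}`, `3`: `{16,23,45}`, `4`: `{16,25,34}` (offsets from `j`).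
[cite: KhristoforovSmirnov2021, §1.2 (arXiv v1 p. 2: link patterns)] -/
private def rel₇' (j : Fin 7) (m : Fin 5) : Finset (Fin 7 × Fin 7) :=
  match m with
  | 0 => {(j+1, j+2), (j+2, j+1), (j+3, j+4), (j+4, j+3), (j+5, j+6), (j+6, j+5)}
  | 1 => {(j+1, j+2), (j+2, j+1), (j+3, j+6), (j+6, j+3), (j+4, j+5), (j+5, j+4)}
  | 2 => {(j+1, j+4), (j+4, j+1), (j+2, j+3), (j+3, j+2), (j+5, j+6), (j+6, j+5)}
  | 3 => {(j+1, j+6), (j+6, j+1), (j+2, j+3), (j+3, j+2), (j+4, j+5), (j+5, j+4)}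
  | 4 => {(j+1, j+6), (j+6, j+1), (j+2, j+5), (j+5, j+2), (j+3, j+4), (j+4, j+3)}

/-- (private copy of the tree's `MarkedLoopTripodBasisSeven.relation_seven`, same proof, for import economy) ★ **THE PATTERNS OF SEVEN CORNERS**: the relation of a pattern with partner `j` is one of the five non-crossing perfect matchings of the
other six corners. [cite: KhristoforovSmirnov2021, §1.2 (arXiv v1 pp. 2–3: «disjoint paths, matching marked points»)] -/
private theorem relation_seven' {j : Fin 7} {L : Finset (Fin 7 × Fin 7)} (hP : IsPattern j L) : ∃ m : Fin 5, L = rel₇' j m := by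
  -- bookkeeping in ℤ/7
  have others : ∀ j x : Fin 7, x ≠ j → x = j + 1 ∨ x = j + 2 ∨ x = j + 3 ∨ x = j + 4 ∨ x = j + 5 ∨ x = j + 6 := by decide
  have dis : ∀ j : Fin 7, j + 1 ≠ j ∧ j + 2 ≠ j ∧ j + 3 ≠ j ∧ j + 4 ≠ j ∧ j + 5 ≠ j ∧ j + 6 ≠ j := by decide
  obtain ⟨n1, n2, n3, n4, n5, n6⟩ := dis j
  have Q : ∀ (a b c d : Fin 7), a < b → b < c → c < d → ∀ j : Fin 7, CcwQuad (j + a) (j + b) (j + c) (j + d) := by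
    unfold CcwQuad; decide +kernel
  have q1234 := Q 1 2 3 4 (by decide) (by decide) (by decide) j
  have q1235 := Q 1 2 3 5 (by decide) (by decide) (by decide) j
  have q1236 := Q 1 2 3 6 (by decide) (by decide) (by decide) j
  have q1256 := Q 1 2 5 6 (by decide) (by decide) (by decide) j
  have q1356 := Q 1 3 5 6 (by decide) (by decide) (by decide) j
  have q1456 := Q 1 4 5 6 (by decide) (by decide) (by decide) j
  have q3456 := Q 3 4 5 6 (by decide) (by decide) (by decide) j
  have q1245 := Q 1 2 4 5 (by decide) (by decide) (by decide) j
  have q1246 := Q 1 2 4 6 (by decide) (by decide) (by decide) j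
  have q2345 := Q 2 3 4 5 (by decide) (by decide) (by decide) j
  have huniq : ∀ {a c d : Fin 7}, (a, c) ∈ L → (a, d) ∈ L → c = d := fun hc hd => hP.partner_eq hc hd
  -- the partner of `j+1`
  obtain ⟨b, hb, -⟩ := hP.perfect (j + 1) n1
  have hbj : b ≠ j := hP.off₂ hb
  have hb' := hP.symm _ _ hb
  -- generic extensionality step: once three chords (with both orientations) lie in `L`, `L` IS that relation
  have ext_of : ∀ {a₁ b₁ a₂ b₂ a₃ b₃ : Fin 7}, (a₁, b₁) ∈ L → (a₂, b₂) ∈ L → (a₃, b₃) ∈ L →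
      (∀ x : Fin 7, x ≠ j → x = a₁ ∨ x = b₁ ∨ x = a₂ ∨ x = b₂ ∨ x = a₃ ∨ x = b₃) →
      L = {(a₁, b₁), (b₁, a₁), (a₂, b₂), (b₂, a₂), (a₃, b₃), (b₃, a₃)} := by
    intro a₁ b₁ a₂ b₂ a₃ b₃ h1 h2 h3 hcov
    have h1' := hP.symm _ _ h1
    have h2' := hP.symm _ _ h2
    have h3' := hP.symm _ _ h3
    ext ⟨x, y⟩
    simp only [Finset.mem_insert, Finset.mem_singleton, Prod.mk.injEq]
    constructor
    · intro hxy
      have hxj : x ≠ j := hP.off x y hxy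
      rcases hcov x hxj with rfl | rfl | rfl | rfl | rfl | rfl
      · exact Or.inl ⟨rfl, huniq h1 hxy ▸ rfl⟩
      · exact Or.inr (Or.inl ⟨rfl, huniq h1' hxy ▸ rfl⟩)
      · exact Or.inr (Or.inr (Or.inl ⟨rfl, huniq h2 hxy ▸ rfl⟩))
      · exact Or.inr (Or.inr (Or.inr (Or.inl ⟨rfl, huniq h2' hxy ▸ rfl⟩)))
      · exact Or.inr (Or.inr (Or.inr (Or.inr (Or.inl ⟨rfl, huniq h3 hxy ▸ rfl⟩))))
      · exact Or.inr (Or.inr (Or.inr (Or.inr (Or.inr ⟨rfl, huniq h3' hxy ▸ rfl⟩))))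
    · rintro (⟨rfl, rfl⟩ | ⟨rfl, rfl⟩ | ⟨rfl, rfl⟩ | ⟨rfl, rfl⟩ | ⟨rfl, rfl⟩ | ⟨rfl, rfl⟩)
      · exact h1
      · exact h1'
      · exact h2
      · exact h2'
      · exact h3
      · exact h3'
  -- the partner of a given other corner lies among the others and differs from known-matched ones
  have partner_in : ∀ {x y : Fin 7}, (x, y) ∈ L → y ≠ j ∧ y ≠ x := fun h => ⟨hP.off₂ h, fun e => hP.ne_of_mem h e.symm⟩
  -- exclusion: if `(s, p) ∈ L` then `(x, s) ∈ L` forces `x = p`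
  have excl : ∀ {x s p : Fin 7}, (s, p) ∈ L → (x, s) ∈ L → x = p := fun hsp hxs => huniq (hP.symm _ _ hxs) hsp
  rcases others j b hbj with rfl | rfl | rfl | rfl | rfl | rfl
  · -- b = j+1: impossible
    exact absurd rfl (hP.ne_of_mem hb)
  · -- j+1 ~ j+2
    obtain ⟨c, hc, -⟩ := hP.perfect (j + 3) n3
    obtain ⟨hcj, hc3⟩ := partner_in hc
    have hc' := hP.symm _ _ hc
    rcases others j c hcj with rfl | rfl | rfl | rfl | rfl | rfl
    · exact absurd (add_left_cancel (excl hb hc)) (by decide)   -- (j+3, j+1): partner of j+1 is j+2 ⇒ j+3 = j+2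
    · exact absurd (add_left_cancel (excl hb' hc)) (by decide)
    · exact absurd rfl hc3
    · -- j+3 ~ j+4 ⇒ j+5 ~ j+6 : m = 0
      obtain ⟨d, hd, -⟩ := hP.perfect (j + 5) n5
      obtain ⟨hdj, hd5⟩ := partner_in hd
      have hd6 : d = j + 6 := by
        rcases others j d hdj with rfl | rfl | rfl | rfl | rfl | rfl
        · exact absurd (add_left_cancel (excl hb hd)) (by decide)
        · exact absurd (add_left_cancel (excl hb' hd)) (by decide)
        · exact absurd (add_left_cancel (excl hc hd)) (by decide)
        · exact absurd (add_left_cancel (excl hc' hd)) (by decide)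
        · exact absurd rfl hd5
        · rfl
      subst hd6
      refine ⟨0, ?_⟩
      rw [ext_of hb hc hd (fun x hx => ?_)]
      · rfl
      · rcases others j x hx with h | h | h | h | h | h <;> simp [h]
    · -- j+3 ~ j+5: crossing with the partner of j+4
      exfalso
      obtain ⟨d, hd, -⟩ := hP.perfect (j + 4) n4
      obtain ⟨hdj, hd4⟩ := partner_in hd
      rcases others j d hdj with rfl | rfl | rfl | rfl | rfl | rfl
      · exact absurd (add_left_cancel (excl hb hd)) (by decide)
      · exact absurd (add_left_cancel (excl hb' hd)) (by decide)
      · exact absurd (add_left_cancel (excl hc hd)) (by decide)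
      · exact absurd rfl hd4
      · exact absurd (add_left_cancel (excl hc' hd)) (by decide)
      · exact hP.planar _ _ _ _ hc hd q3456
    · -- j+3 ~ j+6 ⇒ j+4 ~ j+5 : m = 1
      obtain ⟨d, hd, -⟩ := hP.perfect (j + 4) n4
      obtain ⟨hdj, hd4⟩ := partner_in hd
      have hd5 : d = j + 5 := by
        rcases others j d hdj with rfl | rfl | rfl | rfl | rfl | rfl
        · exact absurd (add_left_cancel (excl hb hd)) (by decide)
        · exact absurd (add_left_cancel (excl hb' hd)) (by decide)
        · exact absurd (add_left_cancel (excl hc hd)) (by decide)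
        · exact absurd rfl hd4
        · rfl
        · exact absurd (add_left_cancel (excl hc' hd)) (by decide)
      subst hd5
      refine ⟨1, ?_⟩
      rw [ext_of hb hc hd (fun x hx => ?_)]
      · rfl
      · rcases others j x hx with h | h | h | h | h | h <;> simp [h]
  · -- j+1 ~ j+3: crossing with the partner of j+2
    exfalso
    obtain ⟨c, hc, -⟩ := hP.perfect (j + 2) n2
    obtain ⟨hcj, hc2⟩ := partner_in hc
    rcases others j c hcj with rfl | rfl | rfl | rfl | rfl | rfl
    · exact absurd (add_left_cancel (excl hb hc)) (by decide)
    · exact absurd rfl hc2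
    · exact absurd (add_left_cancel (excl hb' hc)) (by decide)
    · exact hP.planar _ _ _ _ hb hc q1234
    · exact hP.planar _ _ _ _ hb hc q1235
    · exact hP.planar _ _ _ _ hb hc q1236
  · -- j+1 ~ j+4 ⇒ j+2 ~ j+3 and j+5 ~ j+6 : m = 2
    obtain ⟨c, hc, -⟩ := hP.perfect (j + 2) n2
    obtain ⟨hcj, hc2⟩ := partner_in hc
    have hc3 : c = j + 3 := by
      rcases others j c hcj with rfl | rfl | rfl | rfl | rfl | rfl
      · exact absurd (add_left_cancel (excl hb hc)) (by decide)
      · exact absurd rfl hc2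
      · rfl
      · exact absurd (add_left_cancel (excl hb' hc)) (by decide)
      · exact absurd q1245 (hP.planar _ _ _ _ hb hc)
      · exact absurd q1246 (hP.planar _ _ _ _ hb hc)
    subst hc3
    have hc' := hP.symm _ _ hc
    obtain ⟨d, hd, -⟩ := hP.perfect (j + 5) n5
    obtain ⟨hdj, hd5⟩ := partner_in hd
    have hd6 : d = j + 6 := by
      rcases others j d hdj with rfl | rfl | rfl | rfl | rfl | rfl
      · exact absurd (add_left_cancel (excl hb hd)) (by decide)
      · exact absurd (add_left_cancel (excl hc hd)) (by decide)
      · exact absurd (add_left_cancel (excl hc' hd)) (by decide)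
      · exact absurd (add_left_cancel (excl hb' hd)) (by decide)
      · exact absurd rfl hd5
      · rfl
    subst hd6
    refine ⟨2, ?_⟩
    rw [ext_of hb hc hd (fun x hx => ?_)]
    · rfl
    · rcases others j x hx with h | h | h | h | h | h <;> simp [h]
  · -- j+1 ~ j+5: crossing with the partner of j+6
    exfalso
    obtain ⟨c, hc, -⟩ := hP.perfect (j + 6) n6
    obtain ⟨hcj, hc6⟩ := partner_in hc
    have hc' := hP.symm _ _ hc
    rcases others j c hcj with rfl | rfl | rfl | rfl | rfl | rfl
    · exact absurd (add_left_cancel (excl hb hc)) (by decide)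
    · exact hP.planar _ _ _ _ hb hc' q1256
    · exact hP.planar _ _ _ _ hb hc' q1356
    · exact hP.planar _ _ _ _ hb hc' q1456
    · exact absurd (add_left_cancel (excl hb' hc)) (by decide)
    · exact absurd rfl hc6
  · -- j+1 ~ j+6
    obtain ⟨c, hc, -⟩ := hP.perfect (j + 2) n2
    obtain ⟨hcj, hc2⟩ := partner_in hc
    rcases others j c hcj with rfl | rfl | rfl | rfl | rfl | rfl
    · exact absurd (add_left_cancel (excl hb hc)) (by decide)
    · exact absurd rfl hc2
    · -- j+2 ~ j+3 ⇒ j+4 ~ j+5 : m = 3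
      have hc' := hP.symm _ _ hc
      obtain ⟨d, hd, -⟩ := hP.perfect (j + 4) n4
      obtain ⟨hdj, hd4⟩ := partner_in hd
      have hd5 : d = j + 5 := by
        rcases others j d hdj with rfl | rfl | rfl | rfl | rfl | rfl
        · exact absurd (add_left_cancel (excl hb hd)) (by decide)
        · exact absurd (add_left_cancel (excl hc hd)) (by decide)
        · exact absurd (add_left_cancel (excl hc' hd)) (by decide)
        · exact absurd rfl hd4
        · rfl
        · exact absurd (add_left_cancel (excl hb' hd)) (by decide)
      subst hd5
      refine ⟨3, ?_⟩
      rw [ext_of hb hc hd (fun x hx => ?_)]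
      · rfl
      · rcases others j x hx with h | h | h | h | h | h <;> simp [h]
    · -- j+2 ~ j+4: crossing with the partner of j+3
      exfalso
      have hc' := hP.symm _ _ hc
      obtain ⟨d, hd, -⟩ := hP.perfect (j + 3) n3
      obtain ⟨hdj, hd3⟩ := partner_in hd
      rcases others j d hdj with rfl | rfl | rfl | rfl | rfl | rfl
      · exact absurd (add_left_cancel (excl hb hd)) (by decide)
      · exact absurd (add_left_cancel (excl hc hd)) (by decide)
      · exact absurd rfl hd3
      · exact absurd (add_left_cancel (excl hc' hd)) (by decide)
      · exact hP.planar _ _ _ _ hc hd q2345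
      · exact absurd (add_left_cancel (excl hb' hd)) (by decide)
    · -- j+2 ~ j+5 ⇒ j+3 ~ j+4 : m = 4
      have hc' := hP.symm _ _ hc
      obtain ⟨d, hd, -⟩ := hP.perfect (j + 3) n3
      obtain ⟨hdj, hd3⟩ := partner_in hd
      have hd4 : d = j + 4 := by
        rcases others j d hdj with rfl | rfl | rfl | rfl | rfl | rfl
        · exact absurd (add_left_cancel (excl hb hd)) (by decide)
        · exact absurd (add_left_cancel (excl hc hd)) (by decide)
        · exact absurd rfl hd3
        · rfl
        · exact absurd (add_left_cancel (excl hc' hd)) (by decide)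
        · exact absurd (add_left_cancel (excl hb' hd)) (by decide)
      subst hd4
      refine ⟨4, ?_⟩
      rw [ext_of hb hc hd (fun x hx => ?_)]
      · rfl
      · rcases others j x hx with h | h | h | h | h | h <;> simp [h]
    · exact absurd (add_left_cancel (excl hb' hc)) (by decide)


/-- no chord of `rel₇' α m` off `β, γ` crosses a side of the triangle `(α, β, γ)`. [folklore] -/
private def CrossFree (α : Fin 7) (m : Fin 5) (β γ : Fin 7) : Prop :=
  ∀ y w : Fin 7, (y, w) ∈ rel₇' α m → y ≠ β → y ≠ γ → ¬ CcwQuad α y β w ∧ ¬ CcwQuad β y γ w ∧ ¬ CcwQuad γ y α w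

/-- `CrossFree` is decidable (definitional unfolding). [folklore] -/
private instance decCrossFree (α : Fin 7) (m : Fin 5) (β γ : Fin 7) : Decidable (CrossFree α m β γ) :=
  inferInstanceAs (Decidable (∀ y w : Fin 7, (y, w) ∈ rel₇' α m → y ≠ β → y ≠ γ → ¬ CcwQuad α y β w ∧ ¬ CcwQuad β y γ w ∧ ¬ CcwQuad γ y α w))

/-- `reading a r` reads `(α, β, γ)` with relation `rel₇' α m` minus the chords at `β, γ`. [folklore] -/
private def Reads (a : Fin 7) (r : Fin 9) (α : Fin 7) (m : Fin 5) (β γ : Fin 7) : Prop :=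
  (reading a r).1 = α ∧ (reading a r).2.1 = β ∧ (reading a r).2.2.1 = γ ∧
    ∀ x y : Fin 7, (x, y) ∈ (reading a r).2.2.2 ↔ ((x, y) ∈ rel₇' α m ∧ x ≠ β ∧ x ≠ γ)

/-- `Reads` is decidable (definitional unfolding). [folklore] -/
private instance decReads (a : Fin 7) (r : Fin 9) (α : Fin 7) (m : Fin 5) (β γ : Fin 7) : Decidable (Reads a r α m β γ) :=
  inferInstanceAs (Decidable ((reading a r).1 = α ∧ (reading a r).2.1 = β ∧ (reading a r).2.2.1 = γ ∧
    ∀ x y : Fin 7, (x, y) ∈ (reading a r).2.2.2 ↔ ((x, y) ∈ rel₇' α m ∧ x ≠ β ∧ x ≠ γ)))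

/-- the finite bookkeeping: a non-crossing matching `rel₇' α m` containing the chord `{β, γ}` with `(α, β, γ)` anticlockwise and no chord
crossing the triangle is, minus that chord, the relation of a listed reading of `(α, β, γ)`. [folklore] -/
private theorem exists_reading_of_rel₇' : ∀ (α : Fin 7) (m : Fin 5) (β γ : Fin 7), (β, γ) ∈ rel₇' α m → CcwTriple α β γ →
    CrossFree α m β γ → ∃ a : Fin 7, ∃ r : Fin 9, Reads a r α m β γ := by
  decide +kernel

/-- ★★ **EVERY TRIPOD PICTURE OF SEVEN DISORDERS IS ONE OF THE 63 READINGS** (cons/adj, cons/nest, mid, up to rotation and cyclic reading) —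
the k = 7 analogue of `tripodPicture_five`; no census. [cite: KhristoforovSmirnov2021, §2 Lemma 4, proof and Fig. 3 (arXiv v1 p. 4); §1.2 (p. 2)] -/
theorem tripodPicture_seven_mem {α β γ : Fin 7} {L₀ : Finset (Fin 7 × Fin 7)} (h : TripodPicture α β γ L₀) : (α, β, γ, L₀) ∈ pics7 := by
  obtain ⟨m, hm⟩ := relation_seven' h.isPattern_lo
  have hβγ : (β, γ) ∈ rel₇' α m := by rw [← hm, mem_withPair]; exact Or.inl ⟨rfl, rfl⟩
  have hL : ∀ x y : Fin 7, (x, y) ∈ L₀ ↔ ((x, y) ∈ rel₇' α m ∧ x ≠ β ∧ x ≠ γ) := by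
    intro x y
    rw [← hm, mem_withPair]
    constructor
    · intro hxy
      obtain ⟨-, hxβ, hxγ⟩ := h.off x y hxy
      exact ⟨Or.inr (Or.inr hxy), hxβ, hxγ⟩
    · rintro ⟨h3, h1, h2⟩
      rcases h3 with ⟨rfl, rfl⟩ | ⟨rfl, rfl⟩ | h3
      · exact absurd rfl h1
      · exact absurd rfl h2
      · exact h3
  have hx : CrossFree α m β γ := by
    intro y w hyw h1 h2
    have hL₀ : (y, w) ∈ L₀ := (hL y w).2 ⟨hyw, h1, h2⟩
    refine ⟨h.planar _ _ _ _ ?_ hL₀, h.planar _ _ _ _ ?_ hL₀, h.planar _ _ _ _ ?_ hL₀⟩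
    · rw [mem_withPair, mem_withPair, mem_withPair]; exact Or.inr (Or.inr (Or.inr (Or.inr (Or.inl ⟨rfl, rfl⟩))))
    · rw [mem_withPair, mem_withPair]; exact Or.inr (Or.inr (Or.inl ⟨rfl, rfl⟩))
    · rw [mem_withPair]; exact Or.inl ⟨rfl, rfl⟩
  obtain ⟨a, r, e₁, e₂, e₃, he⟩ := exists_reading_of_rel₇' α m β γ hβγ h.ccw hx
  have hL' : (reading a r).2.2.2 = L₀ := by
    ext ⟨x, y⟩
    rw [he, hL]
  rw [mem_pics7]
  exact ⟨a, r, by rw [← e₁, ← e₂, ← e₃, ← hL']⟩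

/-- ★★ **THE PICTURES OF SEVEN DISORDERS, EXACTLY**: `TripodPicture α β γ L₀ ↔ (α, β, γ, L₀) ∈ pics7`.
[cite: KhristoforovSmirnov2021, §2 Lemma 4, proof and Fig. 3 (arXiv v1 p. 4)] -/
theorem tripodPicture_seven_iff {α β γ : Fin 7} {L₀ : Finset (Fin 7 × Fin 7)} : TripodPicture α β γ L₀ ↔ (α, β, γ, L₀) ∈ pics7 :=
  ⟨tripodPicture_seven_mem, tripodPicture_of_mem_pics7⟩

/-- ★ **THE TRIPOD LAW AT SEVEN MARKS IS TWENTY-ONE RELATIONS**: `TripodLaw wt ↔ A_a(wt) = N_a(wt) = M_a(wt) = 0` for the seven classes `a`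
(every tripod picture is a reading of a class, and a reading's defect is a unit times the class defect).
[cite: KhristoforovSmirnov2021, §2 Lemma 4, proof and Fig. 3 (arXiv v1 p. 4)] -/
theorem tripodLaw_seven_iff (wt : Fin 7 → Finset (Fin 7 × Fin 7) → ℂ) :
    TripodLaw wt ↔ ∀ a : Fin 7, defA wt a = 0 ∧ defN wt a = 0 ∧ defM wt a = 0 := by
  constructor
  · exact fun h a => classDefects_eq_zero_of_tripodLaw h a
  · intro h
    rw [tripodLaw_iff_tripodDefect]
    intro α β γ L₀ hP
    obtain ⟨a, r, e⟩ := mem_pics7.1 (tripodPicture_seven_mem hP)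
    obtain ⟨hA, hN, hM⟩ := h a
    have h9 : ∀ r : Fin 9, r = 0 ∨ r = 1 ∨ r = 2 ∨ r = 3 ∨ r = 4 ∨ r = 5 ∨ r = 6 ∨ r = 7 ∨ r = 8 := by decide
    have key : defectAt wt (reading a r) = 0 := by
      rcases h9 r with rfl | rfl | rfl | rfl | rfl | rfl | rfl | rfl | rfl
      · rw [defectAt_reading_zero, hA]
      · rw [defectAt_reading_one, hA, mul_zero]
      · rw [defectAt_reading_two, hA, mul_zero]
      · rw [defectAt_reading_three, hN]
      · rw [defectAt_reading_four, hN, mul_zero]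
      · rw [defectAt_reading_five, hN, mul_zero]
      · rw [defectAt_reading_six, hM]
      · rw [defectAt_reading_seven, hM, mul_zero]
      · rw [defectAt_reading_eight, hM, mul_zero]
    rw [e] at key
    exact key

end Literature.Probability.Percolation.MarkedLoops
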